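/-
Copyright (c) 2026 the pub-hodgecm-mathlib formalisation cell (harness21).  Prover seat hodgecm-mathlib-LH4-p03 (g4) on line LH3 (closer stub `stub_N9`, N9 «Transf» road),
organ (Δ-ATLAS) of LH3-plan (g2) BRICK BY NAME 2026-09-02T06:15:52Z; 2026-09-02.
-/
import Literature.NumberTheory.Rogawski1990.ArchExplicitTransferFactorEndoTorus   -- ★ p849753 (LH3-p04 (g2)) PART 1: `H`-side readings on the atlas; brings ★ p849548 `ArchExplicitTransferFactorCayleyTorus` (Δ″ = K_ρ·τ·D on the Cayley family) and both ★ atlases (`endoTorus`, `gprimeTorus`)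
import Literature.NumberTheory.Rogawski1990.ArchTransfFamily                     -- ★ p849747 (LH7-p02 (g2)): `slotPerm`, `slotSign`, `partnerPerms`
import Literature.NumberTheory.Rogawski1990.ArchEndoscopicAtlasNormPair           -- ED. 2: ★ LH3-p04 (g2) (I₁-Δ-S) PART 2a `isArchNormPair_endoTorus_gprimeTorus` (general chart); brings ★ p849753's `boostEig` readings
import Literature.NumberTheory.Rogawski1990.ArchExplicitTransferFactorAtlasGeneral   -- ED. 3: ★ p849874 LH3-p04 (g2) (I₁-Δ-S) PART 2b `archKappaAt_atlas_eq_of_ne_zero∕_eq_zero`, `archExplicitDelta_atlas_eq_mul`, `exists_archExplicitDelta_atlas_eq_prod` (general chart, raw `ρ`)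
import HarnessLib

/-!
# Rogawski's explicit factor `Δ″_∞` READ ON THE CARTAN ATLAS: the compact chart `S = ∅` — the partner dictionary `gprimeTorus α ∅ (slotPerm ρ c) = t(e^{ic} ∘ ρ′)`,
# `κ`-TABLE, `Δ″(endoTorus ∅ c, gprimeTorus α ∅ (slotPerm ρ c)) = K_ρ · τ · D`, and the Laurent form under the μ-guard (Rogawski 1990 §8.2 p. 119, §4.9 p. 55, §14.6 p. 242)

Topic `NumberTheory/Rogawski1990`; namespace `Literature.NumberTheory.Rogawski1990`.  THEOREMS ONLY (no `def`, no instance, no notation, no axiom, no named fact, no `sorry`);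
kernel lane `--supports stmt-HodgeConjecture-24833`.  Cell `pub/hodgecm-mathlib` (D-0151), crux H413 = `stmt-HodgeConjecture-24833`; line LH3 (closer stub `stub_N9`, the
N9 «Transf» DIRECT ROAD; LH3-plan (g2) BRICK BY NAME «(Δ-ATLAS)» 2026-09-02T06:15:52Z, part (a): the compact chart `S = ∅`).  Consumer: organ O-L2 of the LH3 leaf (the
closed forms the prover multiplies `F` by inside `transfFamReg`, ★ `ArchTransfFamily`: `Δ″(endoTorus S c, gprimeTorus α S (slotPerm ρ c))` for `ρ ∈ partnerPerms S`).
HONEST LABEL: HC_CM is proved only modulo the 7 printed citations (2 remaining: hLiu418 = stmt-HodgeConjecture-24832, h413 = stmt-HodgeConjecture-24833) until rung 0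
closes; this file is count-neutral kit for the LH3 direct road and pays nothing by itself.

THE MATHEMATICS.  ★ p849548 computes `Δ″_∞` along LH3-p04's Cayley-frame family `γ_H(z)` of `H_∞` against the relabelled diagonal partners `t(z ∘ ρ′)` of
`G′_∞ = U(diag α)(L⁺ ⊗ ℝ)` (`ρ′ : W → S₃` in LINE order).  The organs of the direct road read both sides on the CARTAN ATLAS (★ `ArchEndoscopicCartanAtlas`,
★ `ArchInnerFormCartanAtlas`): `H`-side `endoTorus S c`, `G′`-side `gprimeTorus α S c`, partners `slotPerm ρ c` (`(slotPerm ρ c) w i = c w (ρ w i)`, `ρ` in SLOT order).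
AT THE COMPACT CHART `S = ∅` the two currencies agree up to TWO DICTIONARIES:
* `H`-side (★ `endoTorus_empty`, LH3-p03): `endoTorus ∅ c = γ_H(e^{ic})` LITERALLY, `z_{w,i} = e^{i c w i}` (2-block eigenvalues `e^{i c w 0}, e^{i c w 2}`, 1-block `e^{i c w 1}`);
* `G′`-side (this file, §1): `gprimeTorus α ∅ c = t(w ↦ ℓ ↦ e^{i c w (τ_w⁻¹ ℓ)})` with the slot-to-line bijection `τ_w = lineOf (formSign L α w)` (slot `0` ↦ first even-sign line,
  slot `1` ↦ second even line, slot `2` ↦ odd line), hence **`gprimeTorus α ∅ (slotPerm ρ c) = t(e^{ic} ∘ ρ′)` with the LINE-ORDER relabelling `ρ′_w := τ_w⁻¹ ≫ ρ_w`**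
  (`ρ′_w ℓ = ρ_w (τ_w⁻¹ ℓ)`, i.e. `ρ′_w = ρ_w · τ_w⁻¹` in `S₃`); the `u`-eigenvalue `e^{i c w 1}` of the partner sits on the line `τ_w(ρ_w⁻¹ 1)`, whose form sign is
  `slotSign L α w (ρ_w⁻¹ 1)` (★ `slotSign w k = formSign w (lineOf k)`).
Through the dictionaries every head of ★ p849548 becomes a statement about `(endoTorus ∅ c, gprimeTorus α ∅ (slotPerm ρ c))`: the pair MATCHES (`IsArchNormPair`), the
(κ-TABLE) `κ_w = slotSign w (ρ_w⁻¹ 1) · η_w` off the `G`-walls `q_w := (e^{ic_{w1}} − e^{ic_{w0}})(e^{ic_{w1}} − e^{ic_{w2}}) ≠ 0` and `κ_w = 0` on them,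
**`Δ″ = K_ρ · τ(endoTorus ∅ c) · D_{G∕H,∞}(endoTorus ∅ c)`** with `K_ρ := Π_w slotSign w (ρ_w⁻¹ 1) · η_w ∈ {0, ±1}` CONSTANT in `c`, and under the μ-guard
(★ `exists_odd_archHeckeValue_single_eq_zpow`) the LAURENT FORM **`Δ″ = K_ρ · Π_w [−(e^{ic_{w0}} e^{ic_{w2}})^{k_w} · q_w ∕ e^{ic_{w1}}]`** for ALL `c`, ALL `ρ`, ONE `k : W → ℤ`
[Rogawski p. 119: «`τ(γ)|A₁A₂| = μ(e^{iφ})e^{2i(φ−θ)t}(e^{i(φ−θ−ψ)} − 1)(1 − e^{i(φ−θ+ψ)})`»].  For the identity relabelling `ρ = 1` the slot is `1` (the second even line) and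
`K_1 = Π_w slotSign w 1 · η_w`.

* §1 `gprimeTorus_empty_eq_archDiagTorus`, `gprimeTorus_empty_slotPerm_eq_archDiagTorus` (the `G′`-side dictionary, `ρ ↦ ρ′`);
* §2 `isArchNormPair_endoTorus_empty_gprimeTorus_slotPerm`, `archKappaAt_endoTorus_empty_gprimeTorus_slotPerm_eq_of_ne_zero` ∕ `…_eq_zero` (κ-TABLE in slot currency);
* §3 **`archExplicitDelta_endoTorus_empty_gprimeTorus_slotPerm_eq_mul`** (`Δ″ = K_ρ·τ·D`, all `c`), **`exists_archExplicitDelta_endoTorus_empty_gprimeTorus_slotPerm_eq_prod`**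
  (the Laurent form, one `k` for all `c, ρ`), and the `ρ = 1` corollary `archExplicitDelta_endoTorus_empty_gprimeTorus_eq_mul`.
Part (b) (general chart `S ⊆ splitChartPlaces L α`: the boost partners at `w ∈ S`) is the next edition ∕ LH3-p04 (g2)'s (I₁-Δ-S) PART 2 per LH3-plan's ruling.

EDITION 2 (LH3-plan (g2) ruling (2) 2026-09-02T06:28:37Z, OPTION (α): the `κ`-table of the boost partner and `Δ″` on the general chart are LH3-p04 (g2)'s (I₁-Δ-S) PART 2b;
this file carries the partner-free RIDERS and the slot-currency norm pair).  On the chart `S` (split at `w ∈ S`) the eigenvalue triple at a split place is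
`boostEig (c w) = (e^{x+iθ}, e^{iφ}, e^{−x+iθ})`, `x = c w 0`, `φ = c w 1`, `θ = c w 2`, and `D_{G∕H,∞}(endoTorus S c) = Π_w ‖q_w‖`, `q_w = (E_w1 − E_w0)(E_w1 − E_w2)` (★ p849753
`archWeylRatio_endoTorus`).  Since `‖e^{±x+iθ}‖ = e^{±x} ≠ 1 = ‖e^{iφ}‖` for `x ≠ 0`, **`q_w ≠ 0` at every split place off the Cayley edge `x_w = 0`** — a split chart meets the
`G`-walls (`D = 0`) ONLY through its compact places: on `{c | ∀ w ∈ S, c w 0 ≠ 0}` the vanishing of `D_{G∕H,∞}(endoTorus S c)` is decided by the compact coordinates alone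
(the place-by-place input for «`transfFamReg` is smooth on `RegS S ∩ {x_w ≠ 0}`», O-L2).  The norm-pair rider restates ★ `isArchNormPair_endoTorus_gprimeTorus` (LH3-p04,
`ρ_w = 1` on `S`, partner `fun w => c w ∘ ρ w`) in the currency of ★ `ArchTransfFamily` (`ρ ∈ partnerPerms S`, `slotPerm ρ c` — definitionally the same partner), which is how
`transfFamReg` sums its partners.  ED. 2 heads: §4 `norm_boostEig_zero ∕ _one ∕ _two`, **`boostEig_one_sub_mul_ne_zero`**; §5 **`archWeylRatio_endoTorus_ne_zero_iff`**,
`archWeylRatio_endoTorus_pos_iff`; §6 **`isArchNormPair_endoTorus_gprimeTorus_slotPerm`**.  ED. 3 (after PART 2b ★): the uniform slot re-read `κ_w = slotSign L α w (ρ_w⁻¹ 1)·η_w`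
and `Δ″ = K_ρ·τ·D` on every chart.

EDITION 3 (LH3-plan (g2) ruling (2): «the uniform slot re-read once PART 2b is ★» — ★ p849874 `ArchExplicitTransferFactorAtlasGeneral` landed 06:35Z).  LH3-p04's general-chart
heads are stated for a raw relabelling `ρ : W → S₃` with `ρ_w = 1` on `S` and the partner `fun v => c v ∘ ρ v`, with the sign factor `sgn re σ_w α_{τ_w(ρ_w⁻¹ 1)}`; §7 re-reads them
in the currency the leaf organs quote (★ `ArchTransfFamily`: `ρ ∈ partnerPerms S`, `slotPerm ρ c`, `slotSign L α w (ρ_w⁻¹ 1)` — all three DEFINITIONALLY the same data), so that ONE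
constant `K_ρ = Π_w slotSign L α w (ρ_w⁻¹ 1) · η_w` serves EVERY chart: §7 `archKappaAt_endoTorus_gprimeTorus_slotPerm_eq_of_ne_zero ∕ _eq_zero` (κ-TABLE, both kinds of places),
**`archExplicitDelta_endoTorus_gprimeTorus_slotPerm_eq_mul`** (`Δ″ = K_ρ·τ·D`, all `c`), **`exists_archExplicitDelta_endoTorus_gprimeTorus_slotPerm_eq_prod`** (the closed form under the
μ-guard, `E_w = boostEig (c w)` at `w ∈ S`).  The `S = ∅` heads of §2–§3 are the special case (`partnerPerms ∅ = univ`).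

## References
* [Rogawski1990] J. D. Rogawski, *Automorphic Representations of Unitary Groups in Three Variables*, Ann. of Math. Stud. 123 (1990), §8.2 p. 119 (`τ(γ)|A₁A₂|` explicit), §4.9 p. 55
  (`τ`, `D_{G∕H}`, `Δ`), §14.6 p. 242 (`κ`), §3.6 p. 31 (Cartan subgroups), §4.3 (4.3.1) p. 43.
* [LanglandsShelstad1987] R. P. Langlands, D. Shelstad, *On the definition of transfer factors*, Math. Ann. 278 (1987), §2, Lemma 4.1.A.
* [Shelstad1979] D. Shelstad, *Characters and inner forms of a quasi-split group over ℝ*, Compositio Math. 39 (1979), §4 pp. 22–23, Lemma 4.2 p. 23 (the relabelled partners).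
* [Knapp1986] A. W. Knapp, *Representation Theory of Semisimple Groups* (1986), Ch. V §3 (the boost of `SU(2,1)`, eigenvalues `e^{±x+iθ}`).
-/

set_option autoImplicit false

noncomputable section

open NumberField NumberField.InfinitePlace Polynomial Complex Equiv
open scoped MatrixGroups ComplexConjugate Classical
open Literature.NumberTheory.Automorphic Literature.NumberTheory.Automorphic.UnitaryGroup Literature.NumberTheory.GaloisRepresentations

namespace Literature.NumberTheory.Rogawski1990

section Atlas

variable (L : Type) [Field L] [NumberField L] [IsCMField L] (α : Fin 3 → L) (μ : HeckeCharacter L)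

/-! ## §1 The `G′`-side dictionary at the compact chart -/

/-- **`gprimeTorus α ∅ c` IS a diagonal torus element**: `gprimeTorus α ∅ c = t(w ↦ ℓ ↦ e^{i c w (τ_w⁻¹ ℓ)})`, `τ_w = lineOf (formSign L α w)` — the compact chart puts the
angle `c w k` on the line `τ_w k` (★ `coe_gprimeBlock_of_not_mem`, ★ `gprimeCptGL`; both sides assembled by ★ `archPiEquivCM`). [cite: Rogawski1990, §3.6 p. 31; §4.9 p. 54] -/
theorem gprimeTorus_empty_eq_archDiagTorus (c : {w : InfinitePlace L // IsComplex w} → Fin 3 → ℝ) :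
    gprimeTorus L α ∅ c = archDiagTorus L 3 α fun w ℓ => Circle.exp (c w ((lineOf (formSign L α w)).symm ℓ)) := by
  apply (archPiEquivCM 3 L (Matrix.diagonal α)).injective
  funext w
  rw [archPiEquivCM_gprimeTorus]
  change gprimeBlock L α w ∅ c = archPiEquivCM 3 L (Matrix.diagonal α)
    ((archPiEquivCM 3 L (Matrix.diagonal α)).symm fun w =>
      ⟨circleDiagonal 3 (fun ℓ => Circle.exp (c w ((lineOf (formSign L α w)).symm ℓ))), circleDiagonal_mem_archLocal_diagonal L 3 α w _⟩) w
  rw [ContinuousMulEquiv.apply_symm_apply]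
  apply Subtype.ext
  rw [coe_gprimeBlock_of_not_mem L α c (Finset.notMem_empty w)]
  rfl

/-- **THE PARTNER DICTIONARY `ρ ↦ ρ′`**: `gprimeTorus α ∅ (slotPerm ρ c) = t(e^{ic} ∘ ρ′)` with `ρ′_w := τ_w⁻¹ ≫ ρ_w` (`ρ′_w ℓ = ρ_w (τ_w⁻¹ ℓ)`), `τ_w = lineOf (formSign L α w)` —
the slot-order relabelling `ρ` of ★ `slotPerm` is the line-order relabelling `ρ′` of ★ p849548's partners `t(z ∘ ρ′)` at `z = e^{ic}`. [cite: Shelstad1979, Lemma 4.2 p. 23]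
[cite: Rogawski1990, §3.6 p. 31] -/
theorem gprimeTorus_empty_slotPerm_eq_archDiagTorus (ρ : {w : InfinitePlace L // IsComplex w} → Perm (Fin 3)) (c : {w : InfinitePlace L // IsComplex w} → Fin 3 → ℝ) :
    gprimeTorus L α ∅ (slotPerm ρ c) = archDiagTorus L 3 α fun w => (fun i => Circle.exp (c w i)) ∘ ((lineOf (formSign L α w)).symm.trans (ρ w)) := by
  rw [gprimeTorus_empty_eq_archDiagTorus]
  rfl

/-! ## §2 The pair matches; the κ-TABLE in slot currency -/

/-- **THE ATLAS PAIR MATCHES at the compact chart**: `(endoTorus ∅ c, gprimeTorus α ∅ (slotPerm ρ c))` is an archimedean norm pair for every `c` and every relabelling `ρ`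
(★ `isArchNormPair_cayleyTorus_relabel` through ★ `endoTorus_empty` and §1). [cite: Rogawski1990, §4.3 (4.3.1) p. 43; §3.6 p. 31] [cite: Shelstad1979, Lemma 4.2 p. 23] -/
theorem isArchNormPair_endoTorus_empty_gprimeTorus_slotPerm (ρ : {w : InfinitePlace L // IsComplex w} → Perm (Fin 3))
    (c : {w : InfinitePlace L // IsComplex w} → Fin 3 → ℝ) :
    IsArchNormPair L (Matrix.diagonal α) (endoTorus L ∅ c) (gprimeTorus L α ∅ (slotPerm ρ c)) := by
  rw [endoTorus_empty, gprimeTorus_empty_slotPerm_eq_archDiagTorus]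
  exact isArchNormPair_cayleyTorus_relabel L α _ rfl (fun w i => Circle.exp (c w i)) fun w => (lineOf (formSign L α w)).symm.trans (ρ w)

/-- **(κ-TABLE) OFF THE `G`-WALLS, slot currency**: for `q_w := (e^{ic_{w1}} − e^{ic_{w0}})(e^{ic_{w1}} − e^{ic_{w2}}) ≠ 0`,
`κ_w(endoTorus ∅ c, gprimeTorus α ∅ (slotPerm ρ c)) = slotSign L α w (ρ_w⁻¹ 1) · η_w(diag α)` — the form sign of the line `τ_w(ρ_w⁻¹ 1)` carrying the `u`-eigenvalue `e^{ic_{w1}}`,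
times the majority sign; CONSTANT in `c` (★ `archKappaAt_cayleyTorus_relabel_eq_of_ne_zero`). [cite: Rogawski1990, §14.6 p. 242] [cite: LanglandsShelstad1987, §2, Lemma 4.1.A] -/
theorem archKappaAt_endoTorus_empty_gprimeTorus_slotPerm_eq_of_ne_zero (ρ : {w : InfinitePlace L // IsComplex w} → Perm (Fin 3))
    (c : {w : InfinitePlace L // IsComplex w} → Fin 3 → ℝ) (w : {w : InfinitePlace L // IsComplex w})
    (hq : ((Circle.exp (c w 1) : ℂ) - (Circle.exp (c w 0) : ℂ)) * ((Circle.exp (c w 1) : ℂ) - (Circle.exp (c w 2) : ℂ)) ≠ 0) :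
    archKappaAt L (Matrix.diagonal α) (endoTorus L ∅ c) w (gprimeTorus L α ∅ (slotPerm ρ c)) =
      (slotSign L α w ((ρ w).symm 1) : ℤ) * archMajoritySign L (Matrix.diagonal α) w := by
  rw [endoTorus_empty, gprimeTorus_empty_slotPerm_eq_archDiagTorus]
  exact archKappaAt_cayleyTorus_relabel_eq_of_ne_zero L α _ rfl (fun w i => Circle.exp (c w i)) (fun w => (lineOf (formSign L α w)).symm.trans (ρ w)) w hq

/-- **(κ-TABLE) AT THE `G`-WALLS**: `κ_w(endoTorus ∅ c, gprimeTorus α ∅ (slotPerm ρ c)) = 0` when `q_w = 0` (★ `archKappaAt_cayleyTorus_relabel_eq_zero`; harmless, `D = 0` there).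
[cite: Rogawski1990, §14.6 p. 242] -/
theorem archKappaAt_endoTorus_empty_gprimeTorus_slotPerm_eq_zero (ρ : {w : InfinitePlace L // IsComplex w} → Perm (Fin 3))
    (c : {w : InfinitePlace L // IsComplex w} → Fin 3 → ℝ) (w : {w : InfinitePlace L // IsComplex w})
    (hq : ((Circle.exp (c w 1) : ℂ) - (Circle.exp (c w 0) : ℂ)) * ((Circle.exp (c w 1) : ℂ) - (Circle.exp (c w 2) : ℂ)) = 0) :
    archKappaAt L (Matrix.diagonal α) (endoTorus L ∅ c) w (gprimeTorus L α ∅ (slotPerm ρ c)) = 0 := by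
  rw [endoTorus_empty, gprimeTorus_empty_slotPerm_eq_archDiagTorus]
  exact archKappaAt_cayleyTorus_relabel_eq_zero L α _ rfl (fun w i => Circle.exp (c w i)) (fun w => (lineOf (formSign L α w)).symm.trans (ρ w)) w hq

/-! ## §3 `Δ″ = K_ρ · τ · D` on the compact chart, and the Laurent form under the μ-guard -/

/-- **`Δ″(endoTorus ∅ c, gprimeTorus α ∅ (slotPerm ρ c)) = K_ρ · τ(endoTorus ∅ c) · D_{G∕H,∞}(endoTorus ∅ c)` FOR ALL `c`**, with the CONSTANT
`K_ρ := Π_w slotSign L α w (ρ_w⁻¹ 1) · η_w(diag α) ∈ {0, ±1}` (★ `archExplicitDelta_cayleyTorus_relabel_eq_mul` through the two dictionaries).  `τ·D` at `endoTorus S c` is read for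
every chart by ★ p849753 (`archWeylRatio_endoTorus`, `exists_archTau_mul_archWeylRatio_endoTorus_eq`). [cite: Rogawski1990, §4.9 p. 55; §14.6 p. 242] [cite: Shelstad1979, Lemma 4.2 p. 23] -/
theorem archExplicitDelta_endoTorus_empty_gprimeTorus_slotPerm_eq_mul (ρ : {w : InfinitePlace L // IsComplex w} → Perm (Fin 3))
    (c : {w : InfinitePlace L // IsComplex w} → Fin 3 → ℝ) :
    archExplicitDelta L (Matrix.diagonal α) (endoTorus L ∅ c) μ (gprimeTorus L α ∅ (slotPerm ρ c)) =
      ((∏ w : {w : InfinitePlace L // IsComplex w}, ((slotSign L α w ((ρ w).symm 1) : ℤ) * archMajoritySign L (Matrix.diagonal α) w) : ℤ) : ℂ) *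
        (archTau L (endoTorus L ∅ c) μ * (archWeylRatio L (endoTorus L ∅ c) : ℂ)) := by
  rw [endoTorus_empty, gprimeTorus_empty_slotPerm_eq_archDiagTorus]
  exact archExplicitDelta_cayleyTorus_relabel_eq_mul L α _ rfl μ (fun w i => Circle.exp (c w i)) fun w => (lineOf (formSign L α w)).symm.trans (ρ w)

/-- **THE IDENTITY RELABELLING**: `Δ″(endoTorus ∅ c, gprimeTorus α ∅ c) = K_1 · τ · D` with `K_1 = Π_w slotSign L α w 1 · η_w` — the `u`-eigenvalue on the second even line
(`slotPerm 1 c = c`). [cite: Rogawski1990, §4.9 p. 55; §14.6 p. 242] -/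
theorem archExplicitDelta_endoTorus_empty_gprimeTorus_eq_mul (c : {w : InfinitePlace L // IsComplex w} → Fin 3 → ℝ) :
    archExplicitDelta L (Matrix.diagonal α) (endoTorus L ∅ c) μ (gprimeTorus L α ∅ c) =
      ((∏ w : {w : InfinitePlace L // IsComplex w}, ((slotSign L α w 1 : ℤ) * archMajoritySign L (Matrix.diagonal α) w) : ℤ) : ℂ) *
        (archTau L (endoTorus L ∅ c) μ * (archWeylRatio L (endoTorus L ∅ c) : ℂ)) := by
  have h := archExplicitDelta_endoTorus_empty_gprimeTorus_slotPerm_eq_mul L α μ 1 c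
  rw [slotPerm_one] at h
  rw [h]
  rfl

/-- **(Δ-ATLAS, compact chart) `Δ″` IS A LAURENT POLYNOMIAL IN THE ANGLES UNDER THE μ-GUARD**: there are integers `k_w` (★ `exists_odd_archHeckeValue_single_eq_zpow`) with, for
ALL `c` and every slot relabelling `ρ`,
`Δ″(endoTorus ∅ c, gprimeTorus α ∅ (slotPerm ρ c)) = K_ρ · Π_w [−(e^{ic_{w0}} e^{ic_{w2}})^{k_w} · (e^{ic_{w1}} − e^{ic_{w0}})(e^{ic_{w1}} − e^{ic_{w2}}) ∕ e^{ic_{w1}}]`,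
`K_ρ = Π_w slotSign L α w (ρ_w⁻¹ 1) · η_w` — a constant times a Laurent monomial times `q`, through every `G`-wall (★ `exists_archExplicitDelta_cayleyTorus_relabel_eq_prod`
through the dictionaries). [cite: Rogawski1990, §8.2 p. 119; §4.9 p. 55; §14.6 p. 242] -/
theorem exists_archExplicitDelta_endoTorus_empty_gprimeTorus_slotPerm_eq_prod
    (hμω : ∀ x : ideleGroup ↥(maximalRealSubfield L), μ (AdeleRing.ideleBaseChange (↥(maximalRealSubfield L)) L x) = quadraticHeckeCharCM L x) :
    ∃ k : {w : InfinitePlace L // IsComplex w} → ℤ, ∀ (c : {w : InfinitePlace L // IsComplex w} → Fin 3 → ℝ)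
      (ρ : {w : InfinitePlace L // IsComplex w} → Perm (Fin 3)),
      archExplicitDelta L (Matrix.diagonal α) (endoTorus L ∅ c) μ (gprimeTorus L α ∅ (slotPerm ρ c)) =
        ((∏ w : {w : InfinitePlace L // IsComplex w}, ((slotSign L α w ((ρ w).symm 1) : ℤ) * archMajoritySign L (Matrix.diagonal α) w) : ℤ) : ℂ) *
          ∏ w : {w : InfinitePlace L // IsComplex w},
            -((((Circle.exp (c w 0) : ℂ) * (Circle.exp (c w 2) : ℂ)) ^ (k w)) *
                (((Circle.exp (c w 1) : ℂ) - (Circle.exp (c w 0) : ℂ)) * ((Circle.exp (c w 1) : ℂ) - (Circle.exp (c w 2) : ℂ))) / (Circle.exp (c w 1) : ℂ)) := by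
  obtain ⟨k, hk⟩ := exists_archExplicitDelta_cayleyTorus_relabel_eq_prod L α _ rfl μ hμω
  refine ⟨k, fun c ρ => ?_⟩
  rw [endoTorus_empty, gprimeTorus_empty_slotPerm_eq_archDiagTorus]
  exact hk (fun w i => Circle.exp (c w i)) fun w => (lineOf (formSign L α w)).symm.trans (ρ w)

end Atlas

/-! ## §4 (ED. 2) The moduli of the boost eigenvalues; no `G`-wall inside a split chart -/

/-- `‖boostEig c 0‖ = e^{c 0}` (`= ‖e^{x+iθ}‖`). [cite: Knapp1986, Ch. V §3] -/
theorem norm_boostEig_zero (cw : Fin 3 → ℝ) : ‖boostEig cw 0‖ = Real.exp (cw 0) := by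
  simp [boostEig, Complex.norm_exp]

/-- `‖boostEig c 1‖ = 1` (`= ‖e^{iφ}‖`). [cite: Knapp1986, Ch. V §3] -/
theorem norm_boostEig_one (cw : Fin 3 → ℝ) : ‖boostEig cw 1‖ = 1 := by
  simp [boostEig, Complex.norm_exp]

/-- `‖boostEig c 2‖ = e^{−c 0}` (`= ‖e^{−x+iθ}‖`). [cite: Knapp1986, Ch. V §3] -/
theorem norm_boostEig_two (cw : Fin 3 → ℝ) : ‖boostEig cw 2‖ = Real.exp (-cw 0) := by
  simp [boostEig, Complex.norm_exp]

/-- **NO `G`-WALL INSIDE A SPLIT CHART**: for `x = c 0 ≠ 0` the factor `q = (e^{iφ} − e^{x+iθ})(e^{iφ} − e^{−x+iθ})` of `D_{G∕H,∞}` at a split place does not vanish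
(`‖e^{±x+iθ}‖ = e^{±x} ≠ 1 = ‖e^{iφ}‖`). [cite: Rogawski1990, §4.9 p. 55; §3.6 p. 31] [cite: Knapp1986, Ch. V §3] -/
theorem boostEig_one_sub_mul_ne_zero {cw : Fin 3 → ℝ} (hx : cw 0 ≠ 0) :
    (boostEig cw 1 - boostEig cw 0) * (boostEig cw 1 - boostEig cw 2) ≠ 0 := by
  refine mul_ne_zero (sub_ne_zero.2 fun h => hx ?_) (sub_ne_zero.2 fun h => hx ?_)
  · have hn := congrArg (fun z : ℂ => ‖z‖) h
    simp only [norm_boostEig_one, norm_boostEig_zero] at hn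
    have h0 : Real.exp (cw 0) = Real.exp 0 := by rw [Real.exp_zero]; exact hn.symm
    exact Real.exp_injective h0
  · have hn := congrArg (fun z : ℂ => ‖z‖) h
    simp only [norm_boostEig_one, norm_boostEig_two] at hn
    have h0 : Real.exp (-cw 0) = Real.exp 0 := by rw [Real.exp_zero]; exact hn.symm
    have := Real.exp_injective h0
    linarith

/-! ## §5 (ED. 2) `D_{G∕H,∞}(endoTorus S c) ≠ 0` is decided at the compact places -/

section Split

variable (L : Type) [Field L] [NumberField L] [IsCMField L]
  (S : Finset {w : InfinitePlace L // IsComplex w}) (c : {w : InfinitePlace L // IsComplex w} → Fin 3 → ℝ)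

/-- **`D_{G∕H,∞}(endoTorus S c) ≠ 0 ↔` no COMPACT-place wall**, off the Cayley edges of the split places: if `c w 0 ≠ 0` for every `w ∈ S`, then
`archWeylRatio (endoTorus S c) ≠ 0 ↔ ∀ w ∉ S, (e^{ic_{w1}} − e^{ic_{w0}})(e^{ic_{w1}} − e^{ic_{w2}}) ≠ 0` (★ `archWeylRatio_endoTorus` + §1). [cite: Rogawski1990, §4.9 p. 55; §3.6 p. 31] -/
theorem archWeylRatio_endoTorus_ne_zero_iff (hx : ∀ w ∈ S, c w 0 ≠ 0) :
    archWeylRatio L (endoTorus L S c) ≠ 0 ↔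
      ∀ w : {w : InfinitePlace L // IsComplex w}, w ∉ S →
        ((Circle.exp (c w 1) : ℂ) - (Circle.exp (c w 0) : ℂ)) * ((Circle.exp (c w 1) : ℂ) - (Circle.exp (c w 2) : ℂ)) ≠ 0 := by
  rw [archWeylRatio_endoTorus L S c, Finset.prod_ne_zero_iff]
  constructor
  · intro h w hw
    have hw' := h w (Finset.mem_univ w)
    rwa [if_neg hw, norm_ne_zero_iff] at hw'
  · intro h w _
    rw [norm_ne_zero_iff]
    by_cases hw : w ∈ S
    · rw [if_pos hw]
      exact boostEig_one_sub_mul_ne_zero (hx w hw)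
    · rw [if_neg hw]
      exact h w hw

/-- `D_{G∕H,∞}(endoTorus S c) > 0 ↔` no compact-place wall (same hypothesis; `D ≥ 0` always, ★ `archWeylRatio_nonneg`). [cite: Rogawski1990, §4.9 p. 55] -/
theorem archWeylRatio_endoTorus_pos_iff (hx : ∀ w ∈ S, c w 0 ≠ 0) :
    0 < archWeylRatio L (endoTorus L S c) ↔
      ∀ w : {w : InfinitePlace L // IsComplex w}, w ∉ S →
        ((Circle.exp (c w 1) : ℂ) - (Circle.exp (c w 0) : ℂ)) * ((Circle.exp (c w 1) : ℂ) - (Circle.exp (c w 2) : ℂ)) ≠ 0 := by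
  rw [← archWeylRatio_endoTorus_ne_zero_iff L S c hx]
  exact ⟨fun h => h.ne', fun h => lt_of_le_of_ne (archWeylRatio_nonneg L _) h.symm⟩

/-! ## §6 (ED. 2) The norm pair in `partnerPerms` ∕ `slotPerm` currency -/

variable (α : Fin 3 → L)

/-- **`endoTorus S c ↔ gprimeTorus α S (slotPerm ρ c)` IS A NORM PAIR for every `ρ ∈ partnerPerms S`** (★ `isArchNormPair_endoTorus_gprimeTorus` of LH3-p04, `ρ_w = 1` on `S` by
★ `eq_one_of_mem_partnerPerms`; `slotPerm ρ c = fun w => c w ∘ ρ w` definitionally) — the guard of ★ `archExplicitDelta` holds for every summand of ★ `transfFamReg`.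
[cite: Rogawski1990, §4.3 (4.3.1) p. 43; §3.6 p. 31] [cite: Shelstad1979, Lemma 4.2 p. 23] -/
theorem isArchNormPair_endoTorus_gprimeTorus_slotPerm (hS : ∀ w ∈ S, w ∈ splitChartPlaces L α)
    {ρ : {w : InfinitePlace L // IsComplex w} → Perm (Fin 3)} (hρ : ρ ∈ partnerPerms S) :
    IsArchNormPair L (Matrix.diagonal α) (endoTorus L S c) (gprimeTorus L α S (slotPerm ρ c)) :=
  isArchNormPair_endoTorus_gprimeTorus L α S c hS ρ fun _ hw => eq_one_of_mem_partnerPerms hρ hw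

end Split

/-! ## §7 (ED. 3) The uniform slot re-read on every chart (over ★ LH3-p04 PART 2b) -/

section General

variable (L : Type) [Field L] [NumberField L] [IsCMField L] (α : Fin 3 → L) (μ : HeckeCharacter L)
  {S : Finset {w : InfinitePlace L // IsComplex w}} (c : {w : InfinitePlace L // IsComplex w} → Fin 3 → ℝ)

/-- **(κ-TABLE ON EVERY CHART, slot currency) OFF THE `G`-WALLS**: for `S ⊆ splitChartPlaces`, `ρ ∈ partnerPerms S` and `q_w = (E_w1 − E_w0)(E_w1 − E_w2) ≠ 0`
(`E_w = boostEig (c w)` at `w ∈ S`, `(e^{i c w ·})` at `w ∉ S`), `κ_w(endoTorus S c, gprimeTorus α S (slotPerm ρ c)) = slotSign L α w (ρ_w⁻¹ 1) · η_w` — at a split place `ρ_w = 1`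
and the slot is `1` (the boost's `u`-eigenline is the second even line). ★ `archKappaAt_atlas_eq_of_ne_zero` re-read. [cite: Rogawski1990, §14.6 p. 242] [cite: LanglandsShelstad1987, §2.4] -/
theorem archKappaAt_endoTorus_gprimeTorus_slotPerm_eq_of_ne_zero (hS : ∀ w ∈ S, w ∈ splitChartPlaces L α)
    {ρ : {w : InfinitePlace L // IsComplex w} → Perm (Fin 3)} (hρ : ρ ∈ partnerPerms S) (w : {w : InfinitePlace L // IsComplex w})
    (hq : (((if w ∈ S then boostEig (c w) else fun i => (Circle.exp (c w i) : ℂ)) 1) - ((if w ∈ S then boostEig (c w) else fun i => (Circle.exp (c w i) : ℂ)) 0)) *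
          (((if w ∈ S then boostEig (c w) else fun i => (Circle.exp (c w i) : ℂ)) 1) - ((if w ∈ S then boostEig (c w) else fun i => (Circle.exp (c w i) : ℂ)) 2)) ≠ 0) :
    archKappaAt L (Matrix.diagonal α) (endoTorus L S c) w (gprimeTorus L α S (slotPerm ρ c)) =
      (slotSign L α w ((ρ w).symm 1) : ℤ) * archMajoritySign L (Matrix.diagonal α) w :=
  archKappaAt_atlas_eq_of_ne_zero L α c w hS ρ (fun _ hw => eq_one_of_mem_partnerPerms hρ hw) hq

/-- **(κ-TABLE ON EVERY CHART) AT THE `G`-WALLS**: `κ_w = 0` when `q_w = 0` (only at compact places once `x_w ≠ 0` on `S`, §5). ★ `archKappaAt_atlas_eq_zero` re-read.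
[cite: Rogawski1990, §14.6 p. 242] -/
theorem archKappaAt_endoTorus_gprimeTorus_slotPerm_eq_zero (hS : ∀ w ∈ S, w ∈ splitChartPlaces L α)
    {ρ : {w : InfinitePlace L // IsComplex w} → Perm (Fin 3)} (hρ : ρ ∈ partnerPerms S) (w : {w : InfinitePlace L // IsComplex w})
    (hq : (((if w ∈ S then boostEig (c w) else fun i => (Circle.exp (c w i) : ℂ)) 1) - ((if w ∈ S then boostEig (c w) else fun i => (Circle.exp (c w i) : ℂ)) 0)) *
          (((if w ∈ S then boostEig (c w) else fun i => (Circle.exp (c w i) : ℂ)) 1) - ((if w ∈ S then boostEig (c w) else fun i => (Circle.exp (c w i) : ℂ)) 2)) = 0) :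
    archKappaAt L (Matrix.diagonal α) (endoTorus L S c) w (gprimeTorus L α S (slotPerm ρ c)) = 0 :=
  archKappaAt_atlas_eq_zero L α c w hS ρ (fun _ hw => eq_one_of_mem_partnerPerms hρ hw) hq

/-- **`Δ″(endoTorus S c, gprimeTorus α S (slotPerm ρ c)) = K_ρ · τ(endoTorus S c) · D_{G∕H,∞}(endoTorus S c)` ON EVERY CHART, FOR ALL `c`**, with the SAME constant
`K_ρ = Π_w slotSign L α w (ρ_w⁻¹ 1) · η_w` as at `S = ∅` (§3): ★ `archExplicitDelta_atlas_eq_mul` (LH3-p04 PART 2b) re-read for `ρ ∈ partnerPerms S`.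
[cite: Rogawski1990, §4.9 p. 55; §14.6 p. 242] [cite: Shelstad1979, Lemma 4.2 p. 23] -/
theorem archExplicitDelta_endoTorus_gprimeTorus_slotPerm_eq_mul (hS : ∀ w ∈ S, w ∈ splitChartPlaces L α)
    {ρ : {w : InfinitePlace L // IsComplex w} → Perm (Fin 3)} (hρ : ρ ∈ partnerPerms S) :
    archExplicitDelta L (Matrix.diagonal α) (endoTorus L S c) μ (gprimeTorus L α S (slotPerm ρ c)) =
      ((∏ w : {w : InfinitePlace L // IsComplex w}, ((slotSign L α w ((ρ w).symm 1) : ℤ) * archMajoritySign L (Matrix.diagonal α) w) : ℤ) : ℂ) *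
        (archTau L (endoTorus L S c) μ * (archWeylRatio L (endoTorus L S c) : ℂ)) :=
  archExplicitDelta_atlas_eq_mul L α μ c hS ρ fun _ hw => eq_one_of_mem_partnerPerms hρ hw

/-- **(Δ-ATLAS, every chart) `Δ″` IN CLOSED FORM UNDER THE μ-GUARD**: one `k : W → ℤ` with, for every `S ⊆ splitChartPlaces`, all `c`, every `ρ ∈ partnerPerms S`,
`Δ″(endoTorus S c, gprimeTorus α S (slotPerm ρ c)) = K_ρ · Π_w [−(E_w0 E_w2)^{k_w} · (E_w1 − E_w0)(E_w1 − E_w2) ∕ E_w1]`, `E_w = boostEig (c w) = (e^{x+iθ}, e^{iφ}, e^{−x+iθ})` at `w ∈ S`,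
`(e^{i c w ·})` at `w ∉ S` — entire in the split coordinates, sign constant per chart (★ `exists_archExplicitDelta_atlas_eq_prod` re-read; §3 is its `S = ∅` case).
[cite: Rogawski1990, §8.2 p. 119; §4.9 p. 55; §14.6 p. 242] -/
theorem exists_archExplicitDelta_endoTorus_gprimeTorus_slotPerm_eq_prod
    (hμω : ∀ x : ideleGroup ↥(maximalRealSubfield L), μ (AdeleRing.ideleBaseChange (↥(maximalRealSubfield L)) L x) = quadraticHeckeCharCM L x) :
    ∃ k : {w : InfinitePlace L // IsComplex w} → ℤ, ∀ (S : Finset {w : InfinitePlace L // IsComplex w}) (_hS : ∀ w ∈ S, w ∈ splitChartPlaces L α)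
      (c : {w : InfinitePlace L // IsComplex w} → Fin 3 → ℝ) (ρ : {w : InfinitePlace L // IsComplex w} → Perm (Fin 3)) (_hρ : ρ ∈ partnerPerms S),
      archExplicitDelta L (Matrix.diagonal α) (endoTorus L S c) μ (gprimeTorus L α S (slotPerm ρ c)) =
        ((∏ w : {w : InfinitePlace L // IsComplex w}, ((slotSign L α w ((ρ w).symm 1) : ℤ) * archMajoritySign L (Matrix.diagonal α) w) : ℤ) : ℂ) *
          ∏ w : {w : InfinitePlace L // IsComplex w},
            -(((((if w ∈ S then boostEig (c w) else fun i => (Circle.exp (c w i) : ℂ)) 0) * ((if w ∈ S then boostEig (c w) else fun i => (Circle.exp (c w i) : ℂ)) 2)) ^ (k w)) *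
                ((((if w ∈ S then boostEig (c w) else fun i => (Circle.exp (c w i) : ℂ)) 1) - ((if w ∈ S then boostEig (c w) else fun i => (Circle.exp (c w i) : ℂ)) 0)) *
                  (((if w ∈ S then boostEig (c w) else fun i => (Circle.exp (c w i) : ℂ)) 1) - ((if w ∈ S then boostEig (c w) else fun i => (Circle.exp (c w i) : ℂ)) 2))) /
              ((if w ∈ S then boostEig (c w) else fun i => (Circle.exp (c w i) : ℂ)) 1)) := by
  obtain ⟨k, hk⟩ := exists_archExplicitDelta_atlas_eq_prod L α μ hμω
  exact ⟨k, fun S hS c ρ hρ => hk S hS c ρ fun _ hw => eq_one_of_mem_partnerPerms hρ hw⟩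

end General

end Literature.NumberTheory.Rogawski1990

end
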